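import Literature.Geometry.Lorentzian.KerrSeparatedPotentialBounds
import HarnessLib

/-!
# Second-order bounds for Carter's separated potential `V = V₀ + V₁` on Kerr:
# `|d²V₀/dr²| ≤ BΛ`, `|dP/dr| ≤ BΛr²`, `|d/dr((r² + a²)³ dV₁/dr)| ≤ Br`
# (Dafermos–Rodnianski–Shlapentokh-Rothman, §8.3 and §8.6, proofs of Lemmas 8.3.1 and 8.6.1)

(family `gr`, infrastructure for statement **gr.S24**; namespace `Literature.Geometry.Lorentzian.Kerr`)

In the proofs of Lemma 8.3.1 (structure of the full potential `V = V₀ + V₁` in the large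
superradiant range `𝓖^♯`) and Lemma 8.6.1 (the same in the trapping range `𝓖_♮`) of
Dafermos–Rodnianski–Shlapentokh-Rothman (*Decay for solutions of the wave equation on Kerr exterior
spacetimes III*, arXiv:1402.7034 = Ann. of Math. 183 (2016)) the passage from the explicit potential
`V₀ = (4Mramω − a²m² + ΔΛ)/(r² + a²)²` of §6 to the full potential rests on the following bounds,
stated there with unspecified constants `B` ("depending only on `a₀`, `M`", resp. on `ε_width`
through `σ = amω/Λ`): `|dV₀/dr| ≤ BΛ`, `|d²V₀/dr²| ≤ BΛ` (proof of Lemma 8.3.1),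
`|dV₀/dr| ≤ BΛr⁻³` (proof of Lemma 8.6.1), the fact that
`Λ⁻¹ d/dr((r² + a²)³ dV₀/dr) = −6(r² − 2Mr + 4Mrσ + a²/3 − (2/3)a²m²/Λ)` "is a quadratic polynomial
with bounded coefficients" (proofs of Lemmas 6.3.1, 8.3.1, 8.6.1), and, for `V₁`,
`|V₁| ≤ Br⁻³`, `|dV₁/dr| ≤ Br⁻⁴`, `|d/dr((r² + a²)³ dV₁/dr)| ≤ Br` (proof of Lemma 8.3.1, last
display), from which "for `ω_high` sufficiently large (and hence large `Λ`) … the full potential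
`V = V₀ + V₁` cannot have any critical points on `[r₊, r₁']` and has a unique maximum
`r_max ∈ [r₁', ∞)` which satisfies `|r_max − r⁰_max| ≤ BΛ⁻¹`".

`KerrSeparatedPotentialBounds.lean` proves the first-order bounds (`|V₀| ≤ 3Λ/r²`, `V₁ ≤ 3M/r³`,
`|(r² + a²)³dV₀/dr| = |P| ≤ 24Λr³`, `|(r² + a²)⁵dV₁/dr| = |P₁| ≤ 184Mr⁶`). This file **proves** the
second-order ones, with explicit constants, for `0 < M ≤ r`, `|a| ≤ M` and an admissible triple
(`Λ ≥ |m|(|m| + 1)`, `Λ ≥ 2|amω|`, Def. 6.1.1):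

* `abs_critPolyDeriv_le`: `|dP/dr| ≤ 36Λr²` (`P = (r² + a²)³ dV₀/dr` the critical-point cubic of
  `KerrSeparatedTrapping.lean`, `dP/dr = critPolyDeriv` the quadratic above times `Λ`);
  `hasDerivAt_critPolyDeriv`: `d²P/dr² = −24Mamω − 12Λ(r − M)`.
* `hasDerivAt_deriv_sepPotential₀`, `abs_deriv_deriv_sepPotential₀_le`:
  `d²V₀/dr² = (dP/dr·(r² + a²) − 6rP)/(r² + a²)⁴` and `|d²V₀/dr²| ≤ 216Λ/r⁴` (`r > 0`, resp.
  `r ≥ M`).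
* `critPoly₁Deriv`, `hasDerivAt_critPoly₁`, `abs_critPoly₁Deriv_le`: `dP₁/dr` (a quintic) and
  `|dP₁/dr| ≤ 528Mr⁵`.
* `hasDerivAt_cube_mul_deriv_sepPotential₁`, `abs_deriv_cube_mul_deriv_sepPotential₁_le`:
  `(r² + a²)³ dV₁/dr = P₁/(r² + a²)²` has derivative `(dP₁/dr·(r² + a²) − 4rP₁)/(r² + a²)³`, of
  absolute value `≤ 1792Mr`.
* `hasDerivAt_cube_mul_deriv_sepPotential`, `abs_deriv_cube_mul_deriv_sepPotential_sub_le`: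
  hence `|d/dr((r² + a²)³ dV/dr) − dP/dr| ≤ 1792Mr` — the form in which the two lemmas use these
  bounds (`dP/dr ≤ −c̃Λr²` on `[r₁', ∞)` then forces `d/dr((r² + a²)³dV/dr) < 0` there once `Λ` is
  large).
* `abs_deriv_deriv_sepPotential₁_le`, `abs_deriv_deriv_sepPotential_le`: `|d²V₁/dr²| ≤ 2896M/r⁵`
  and `|d²V/dr²| ≤ 216Λ/r⁴ + 2896M/r⁵` on `r ≥ M`.

## References

* M. Dafermos, I. Rodnianski, Y. Shlapentokh-Rothman, arXiv:1402.7034 = Ann. of Math. 183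
  (2016), §6.2–§6.3 (the potential and the cubic `P`), §8.3 (proof of Lemma 8.3.1), §8.6 (proof
  of Lemma 8.6.1) (key `DafermosRodnianskiShlapentokhrothman2014`).
-/

noncomputable section

open Set Filter Topology

namespace Literature.Geometry.Lorentzian

namespace Kerr

/-! ### The quadratic `dP/dr` -/

/-- **`|dP/dr| ≤ 36Λr²`** for `0 < M ≤ r`, `|a| ≤ M` and an admissible triple
(`|24Mamωr| ≤ 12ΛMr ≤ 12Λr²`, `4a²m² ≤ 4Λr²`, `|2Λ(3r² − 6Mr + a²)| ≤ 20Λr²`): the coefficients of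
the quadratic `Λ⁻¹ d/dr((r² + a²)³ dV₀/dr)` are bounded (DRSR arXiv:1402.7034, proofs of
Lemmas 8.3.1 and 8.6.1). [cite: DafermosRodnianskiShlapentokhrothman2014, Lemma 8.6.1 (proof)] -/
theorem abs_critPolyDeriv_le {M a ω Λ r : ℝ} {m : ℤ} (hM : 0 < M) (haM : |a| ≤ M)
    (hadm : IsAdmissibleTriple a ω m Λ) (hr : M ≤ r) :
    |critPolyDeriv M a ω m Λ r| ≤ 36 * Λ * r ^ 2 := by
  have hr0 : 0 < r := hM.trans_le hr
  have hΛ : 0 ≤ Λ := hadm.nonneg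
  have ha2 : a ^ 2 ≤ r ^ 2 := by nlinarith [sq_abs a, abs_nonneg a]
  have hT1 : |-24 * M * a * m * ω * r| ≤ 12 * Λ * r ^ 2 := by
    have e : -24 * M * a * m * ω * r = (-24 * M * r) * (a * m * ω) := by ring
    rw [e, abs_mul]
    have h24 : |(-24 * M * r)| = 24 * M * r := by
      rw [abs_of_neg (by nlinarith [mul_pos hM hr0])]; ring
    rw [h24]
    calc 24 * M * r * |a * ↑m * ω| ≤ 24 * M * r * (Λ / 2) := by gcongr; linarith [hadm.2]
      _ = 12 * Λ * (M * r) := by ring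
      _ ≤ 12 * Λ * (r * r) := by gcongr
      _ = 12 * Λ * r ^ 2 := by ring
  have hT2 : |4 * a ^ 2 * (m : ℝ) ^ 2| ≤ 4 * Λ * r ^ 2 := by
    rw [abs_of_nonneg (by positivity)]
    calc 4 * a ^ 2 * (m : ℝ) ^ 2 ≤ 4 * r ^ 2 * Λ := by gcongr; exact hadm.sq_le
      _ = 4 * Λ * r ^ 2 := by ring
  have hT3 : |2 * Λ * (3 * r ^ 2 - 6 * M * r + a ^ 2)| ≤ 20 * Λ * r ^ 2 := by
    rw [abs_mul, abs_of_nonneg (by positivity : (0 : ℝ) ≤ 2 * Λ)]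
    have hb : |3 * r ^ 2 - 6 * M * r + a ^ 2| ≤ 10 * r ^ 2 := by
      rw [abs_le]
      have h2 : M * r ≤ r * r := mul_le_mul_of_nonneg_right hr hr0.le
      have h4 : 0 ≤ M * r := by positivity
      constructor <;> nlinarith
    calc 2 * Λ * |3 * r ^ 2 - 6 * M * r + a ^ 2| ≤ 2 * Λ * (10 * r ^ 2) := by gcongr
      _ = 20 * Λ * r ^ 2 := by ring
  unfold critPolyDeriv
  calc |-24 * M * a * m * ω * r + 4 * a ^ 2 * (m : ℝ) ^ 2 - 2 * Λ * (3 * r ^ 2 - 6 * M * r + a ^ 2)|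
      ≤ |-24 * M * a * m * ω * r + 4 * a ^ 2 * (m : ℝ) ^ 2| +
          |2 * Λ * (3 * r ^ 2 - 6 * M * r + a ^ 2)| := abs_sub _ _
    _ ≤ |-24 * M * a * m * ω * r| + |4 * a ^ 2 * (m : ℝ) ^ 2| +
          |2 * Λ * (3 * r ^ 2 - 6 * M * r + a ^ 2)| := by gcongr; exact abs_add_le _ _
    _ ≤ 12 * Λ * r ^ 2 + 4 * Λ * r ^ 2 + 20 * Λ * r ^ 2 := by gcongr
    _ = 36 * Λ * r ^ 2 := by ring

/-- **`d²P/dr² = −24Mamω − 12Λ(r − M)`** (the quadratic `dP/dr` differentiated).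
[cite: DafermosRodnianskiShlapentokhrothman2014, Lemma 6.3.1 (proof)] -/
theorem hasDerivAt_critPolyDeriv (M a ω : ℝ) (m : ℤ) (Λ r : ℝ) :
    HasDerivAt (critPolyDeriv M a ω m Λ) (-24 * M * a * m * ω - 12 * Λ * (r - M)) r := by
  have h := (((hasDerivAt_pow 2 r).const_mul (-6 * Λ)).add
    ((hasDerivAt_id r).const_mul (-24 * M * a * m * ω + 12 * Λ * M))).add_const
    (4 * a ^ 2 * (m : ℝ) ^ 2 - 2 * Λ * a ^ 2)
  have h' : HasDerivAt (critPolyDeriv M a ω m Λ)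
      (-6 * Λ * (↑(2 : ℕ) * r ^ (2 - 1)) + (-24 * M * a * m * ω + 12 * Λ * M) * 1) r := by
    refine h.congr_of_eventuallyEq (Eventually.of_forall fun s ↦ ?_)
    simp only [critPolyDeriv, id, Pi.add_apply]
    ring
  refine h'.congr_deriv ?_
  push_cast
  ring

/-! ### The second derivative of `V₀` -/

/-- **`d²V₀/dr² = (dP/dr·(r² + a²) − 6rP)/(r² + a²)⁴`** at every `r > 0` (differentiating
`dV₀/dr = P/(r² + a²)³`, valid on the neighbourhood `(0, ∞)` of `r`).
[cite: DafermosRodnianskiShlapentokhrothman2014, Lemma 8.3.1 (proof)] -/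
theorem hasDerivAt_deriv_sepPotential₀ (M a ω : ℝ) (m : ℤ) (Λ : ℝ) {r : ℝ} (hr : 0 < r) :
    HasDerivAt (deriv (sepPotential₀ M a ω m Λ))
      ((critPolyDeriv M a ω m Λ r * (r ^ 2 + a ^ 2) - 6 * r * critPoly M a ω m Λ r) /
        (r ^ 2 + a ^ 2) ^ 4) r := by
  have hD : 0 < r ^ 2 + a ^ 2 := by positivity
  have hD' : r ^ 2 + a ^ 2 ≠ 0 := hD.ne'
  have hcube := hasDerivAt_sq_add_sq_pow a 3 r
  have hquot : HasDerivAt (fun s ↦ critPoly M a ω m Λ s / (s ^ 2 + a ^ 2) ^ 3)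
      ((critPolyDeriv M a ω m Λ r * (r ^ 2 + a ^ 2) ^ 3 -
          critPoly M a ω m Λ r * ((3 : ℕ) * (r ^ 2 + a ^ 2) ^ (3 - 1) * (2 * r))) /
        ((r ^ 2 + a ^ 2) ^ 3) ^ 2) r :=
    (hasDerivAt_critPoly M a ω m Λ r).div hcube (pow_ne_zero 3 hD')
  have heq : deriv (sepPotential₀ M a ω m Λ) =ᶠ[𝓝 r]
      fun s ↦ critPoly M a ω m Λ s / (s ^ 2 + a ^ 2) ^ 3 := by
    filter_upwards [Ioi_mem_nhds hr] with s hs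
    have hs' : (0 : ℝ) < s := hs
    exact deriv_sepPotential₀_eq M a ω m Λ (by positivity : s ^ 2 + a ^ 2 ≠ 0)
  refine (hquot.congr_of_eventuallyEq heq).congr_deriv ?_
  push_cast
  field_simp
  ring

/-- `deriv (deriv V₀) r = (dP/dr·(r² + a²) − 6rP)/(r² + a²)⁴` for `r > 0`.
[cite: DafermosRodnianskiShlapentokhrothman2014, Lemma 8.3.1 (proof)] -/
theorem deriv_deriv_sepPotential₀_eq (M a ω : ℝ) (m : ℤ) (Λ : ℝ) {r : ℝ} (hr : 0 < r) :
    deriv (deriv (sepPotential₀ M a ω m Λ)) r =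
      (critPolyDeriv M a ω m Λ r * (r ^ 2 + a ^ 2) - 6 * r * critPoly M a ω m Λ r) /
        (r ^ 2 + a ^ 2) ^ 4 :=
  (hasDerivAt_deriv_sepPotential₀ M a ω m Λ hr).deriv

/-- **`|d²V₀/dr²| ≤ 216Λ/r⁴`** for `0 < M ≤ r`, `|a| ≤ M` and an admissible triple
(`|dP/dr|(r² + a²) ≤ 72Λr⁴`, `6r|P| ≤ 144Λr⁴`, `(r² + a²)⁴ ≥ r⁸`): the bound "`|d²V₀/dr²| ≤ BΛ`" of
DRSR arXiv:1402.7034, proof of Lemma 8.3.1, in explicit form. [cite: DafermosRodnianskiShlapentokhrothman2014, Lemma 8.3.1 (proof)] -/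
theorem abs_deriv_deriv_sepPotential₀_le {M a ω Λ r : ℝ} {m : ℤ} (hM : 0 < M) (haM : |a| ≤ M)
    (hadm : IsAdmissibleTriple a ω m Λ) (hr : M ≤ r) :
    |deriv (deriv (sepPotential₀ M a ω m Λ)) r| ≤ 216 * Λ / r ^ 4 := by
  have hr0 : 0 < r := hM.trans_le hr
  have hΛ : 0 ≤ Λ := hadm.nonneg
  have hD : 0 < r ^ 2 + a ^ 2 := by positivity
  have ha2 : a ^ 2 ≤ r ^ 2 := by nlinarith [sq_abs a, abs_nonneg a]
  have hD2 : r ^ 2 + a ^ 2 ≤ 2 * r ^ 2 := by linarith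
  have hP := abs_critPoly_le hM haM hadm hr
  have hP' := abs_critPolyDeriv_le hM haM hadm hr
  rw [deriv_deriv_sepPotential₀_eq M a ω m Λ hr0, abs_div, abs_of_pos (pow_pos hD 4)]
  have hnum : |critPolyDeriv M a ω m Λ r * (r ^ 2 + a ^ 2) - 6 * r * critPoly M a ω m Λ r| ≤
      216 * Λ * r ^ 4 := by
    calc |critPolyDeriv M a ω m Λ r * (r ^ 2 + a ^ 2) - 6 * r * critPoly M a ω m Λ r|
        ≤ |critPolyDeriv M a ω m Λ r * (r ^ 2 + a ^ 2)| + |6 * r * critPoly M a ω m Λ r| :=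
          abs_sub _ _
      _ = |critPolyDeriv M a ω m Λ r| * (r ^ 2 + a ^ 2) + 6 * r * |critPoly M a ω m Λ r| := by
          rw [abs_mul, abs_mul, abs_of_pos hD, abs_of_pos (by positivity : (0 : ℝ) < 6 * r)]
      _ ≤ 36 * Λ * r ^ 2 * (2 * r ^ 2) + 6 * r * (24 * Λ * r ^ 3) := by gcongr
      _ = 216 * Λ * r ^ 4 := by ring
  calc |critPolyDeriv M a ω m Λ r * (r ^ 2 + a ^ 2) - 6 * r * critPoly M a ω m Λ r| /
        (r ^ 2 + a ^ 2) ^ 4 ≤ 216 * Λ * r ^ 4 / (r ^ 2 + a ^ 2) ^ 4 := by gcongr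
    _ ≤ 216 * Λ * r ^ 4 / (r ^ 2) ^ 4 := by
        apply div_le_div_of_nonneg_left (by positivity) (by positivity)
        gcongr; nlinarith [sq_nonneg a]
    _ = 216 * Λ / r ^ 4 := by field_simp

/-! ### The quintic `dP₁/dr` -/

/-- The **derivative `dP₁/dr` of the sextic `P₁ = (r² + a²)⁵ dV₁/dr`**:
`−36Mr⁵ + 5(16M² − 4a²)r⁴ + 120Ma²r³ − 3(64M²a² + 8a⁴)r² + 60Ma⁴r + (16M²a⁴ − 4a⁶)`. Not displayed
in DRSR arXiv:1402.7034 (only its consequence `|d/dr((r² + a²)³dV₁/dr)| ≤ Br`, proof of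
Lemma 8.3.1). [folklore] -/
def critPoly₁Deriv (M a r : ℝ) : ℝ :=
  -36 * M * r ^ 5 + 5 * (16 * M ^ 2 - 4 * a ^ 2) * r ^ 4 + 120 * M * a ^ 2 * r ^ 3 -
    3 * (64 * M ^ 2 * a ^ 2 + 8 * a ^ 4) * r ^ 2 + 60 * M * a ^ 4 * r + (16 * M ^ 2 * a ^ 4 - 4 * a ^ 6)

/-- `dP₁/dr = critPoly₁Deriv`. [folklore] -/
theorem hasDerivAt_critPoly₁ (M a r : ℝ) :
    HasDerivAt (critPoly₁ M a) (critPoly₁Deriv M a r) r := by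
  have h := ((((((hasDerivAt_pow 6 r).const_mul (-6 * M)).add
    ((hasDerivAt_pow 5 r).const_mul (16 * M ^ 2 - 4 * a ^ 2))).add
    ((hasDerivAt_pow 4 r).const_mul (30 * M * a ^ 2))).add
    ((hasDerivAt_pow 3 r).const_mul (-(64 * M ^ 2 * a ^ 2 + 8 * a ^ 4)))).add
    ((hasDerivAt_pow 2 r).const_mul (30 * M * a ^ 4))).add
    ((hasDerivAt_id r).const_mul (16 * M ^ 2 * a ^ 4 - 4 * a ^ 6))
  have h' : HasDerivAt (critPoly₁ M a)
      (-6 * M * (↑(6 : ℕ) * r ^ (6 - 1)) + (16 * M ^ 2 - 4 * a ^ 2) * (↑(5 : ℕ) * r ^ (5 - 1)) +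
        30 * M * a ^ 2 * (↑(4 : ℕ) * r ^ (4 - 1)) +
        -(64 * M ^ 2 * a ^ 2 + 8 * a ^ 4) * (↑(3 : ℕ) * r ^ (3 - 1)) +
        30 * M * a ^ 4 * (↑(2 : ℕ) * r ^ (2 - 1)) + (16 * M ^ 2 * a ^ 4 - 4 * a ^ 6) * 1) r := by
    refine (h.add_const (-6 * M * a ^ 6)).congr_of_eventuallyEq (Eventually.of_forall fun s ↦ ?_)
    simp only [critPoly₁, id, Pi.add_apply]
    ring
  refine h'.congr_deriv ?_
  simp only [critPoly₁Deriv]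
  push_cast
  ring

/-- **`|dP₁/dr| ≤ 528Mr⁵`** for `0 < M ≤ r`, `|a| ≤ M` (coefficientwise, using
`a² ≤ M² ≤ Mr ≤ r²`: `36 + 80 + 120 + 216 + 60 + 16 = 528`). [folklore] -/
theorem abs_critPoly₁Deriv_le {M a r : ℝ} (hM : 0 < M) (haM : |a| ≤ M) (hr : M ≤ r) :
    |critPoly₁Deriv M a r| ≤ 528 * M * r ^ 5 := by
  have hr0 : 0 < r := hM.trans_le hr
  have ha2 : a ^ 2 ≤ M ^ 2 := by nlinarith [sq_abs a, abs_nonneg a]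
  have ha4 : a ^ 4 ≤ M ^ 4 := by
    calc a ^ 4 = (a ^ 2) ^ 2 := by ring
      _ ≤ (M ^ 2) ^ 2 := pow_le_pow_left₀ (sq_nonneg a) ha2 2
      _ = M ^ 4 := by ring
  have ha6 : a ^ 6 ≤ M ^ 6 := by
    calc a ^ 6 = (a ^ 2) ^ 3 := by ring
      _ ≤ (M ^ 2) ^ 3 := pow_le_pow_left₀ (sq_nonneg a) ha2 3
      _ = M ^ 6 := by ring
  have hrk : ∀ k : ℕ, M ^ k ≤ r ^ k := fun k ↦ pow_le_pow_left₀ hM.le hr k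
  have hMk : ∀ k : ℕ, M ^ (k + 1) ≤ M * r ^ k := fun k ↦ by
    rw [pow_succ']; exact mul_le_mul_of_nonneg_left (hrk k) hM.le
  have hM3 : M ^ 3 ≤ M * r ^ 2 := hMk 2
  have hM4 : M ^ 4 ≤ M * r ^ 3 := hMk 3
  have hM5 : M ^ 5 ≤ M * r ^ 4 := hMk 4
  have hM6 : M ^ 6 ≤ M * r ^ 5 := hMk 5
  -- the six terms
  have h1 : |-36 * M * r ^ 5| ≤ 36 * M * r ^ 5 := by
    rw [abs_le]; constructor <;> nlinarith [mul_pos hM (pow_pos hr0 5)]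
  have h2 : |5 * (16 * M ^ 2 - 4 * a ^ 2) * r ^ 4| ≤ 80 * M * r ^ 5 := by
    have hc0 : 0 ≤ 16 * M ^ 2 - 4 * a ^ 2 := by nlinarith
    have hc1 : 16 * M ^ 2 - 4 * a ^ 2 ≤ 16 * M ^ 2 := by nlinarith [sq_nonneg a]
    rw [abs_of_nonneg (mul_nonneg (mul_nonneg (by norm_num) hc0) (by positivity))]
    calc 5 * (16 * M ^ 2 - 4 * a ^ 2) * r ^ 4 ≤ 5 * (16 * M ^ 2) * r ^ 4 := by gcongr
      _ = 80 * (M * (M * r ^ 4)) := by ring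
      _ ≤ 80 * (M * (r * r ^ 4)) := by gcongr
      _ = 80 * M * r ^ 5 := by ring
  have h3 : |120 * M * a ^ 2 * r ^ 3| ≤ 120 * M * r ^ 5 := by
    rw [abs_of_nonneg (by positivity)]
    calc 120 * M * a ^ 2 * r ^ 3 ≤ 120 * M * M ^ 2 * r ^ 3 := by gcongr
      _ = 120 * (M ^ 3 * r ^ 3) := by ring
      _ ≤ 120 * ((M * r ^ 2) * r ^ 3) := by gcongr
      _ = 120 * M * r ^ 5 := by ring
  have h4 : |3 * (64 * M ^ 2 * a ^ 2 + 8 * a ^ 4) * r ^ 2| ≤ 216 * M * r ^ 5 := by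
    rw [abs_of_nonneg (by positivity)]
    calc 3 * (64 * M ^ 2 * a ^ 2 + 8 * a ^ 4) * r ^ 2
        ≤ 3 * (64 * M ^ 2 * M ^ 2 + 8 * M ^ 4) * r ^ 2 := by gcongr
      _ = 216 * (M ^ 4 * r ^ 2) := by ring
      _ ≤ 216 * ((M * r ^ 3) * r ^ 2) := by gcongr
      _ = 216 * M * r ^ 5 := by ring
  have h5 : |60 * M * a ^ 4 * r| ≤ 60 * M * r ^ 5 := by
    rw [abs_of_nonneg (by positivity)]
    calc 60 * M * a ^ 4 * r ≤ 60 * M * M ^ 4 * r := by gcongr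
      _ = 60 * (M ^ 5 * r) := by ring
      _ ≤ 60 * ((M * r ^ 4) * r) := by gcongr
      _ = 60 * M * r ^ 5 := by ring
  have h6 : |16 * M ^ 2 * a ^ 4 - 4 * a ^ 6| ≤ 16 * M * r ^ 5 := by
    rw [abs_le]
    have e1 : 0 ≤ M ^ 2 * a ^ 4 := by positivity
    have e2 : 0 ≤ a ^ 6 := by positivity
    have e3 : M ^ 2 * a ^ 4 ≤ M ^ 2 * M ^ 4 := by gcongr
    have e4 : a ^ 6 ≤ M * r ^ 5 := ha6.trans hM6
    have e5 : M ^ 2 * M ^ 4 = M ^ 6 := by ring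
    constructor <;> nlinarith
  unfold critPoly₁Deriv
  have step : ∀ t1 t2 t3 t4 t5 t6 : ℝ,
      |t1 + t2 + t3 - t4 + t5 + t6| ≤ |t1| + |t2| + |t3| + |t4| + |t5| + |t6| := by
    intro t1 t2 t3 t4 t5 t6
    calc |t1 + t2 + t3 - t4 + t5 + t6| ≤ |t1 + t2 + t3 - t4 + t5| + |t6| := abs_add_le _ _
      _ ≤ |t1 + t2 + t3 - t4| + |t5| + |t6| := by gcongr; exact abs_add_le _ _
      _ ≤ |t1 + t2 + t3| + |t4| + |t5| + |t6| := by gcongr; exact abs_sub _ _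
      _ ≤ |t1 + t2| + |t3| + |t4| + |t5| + |t6| := by gcongr; exact abs_add_le _ _
      _ ≤ |t1| + |t2| + |t3| + |t4| + |t5| + |t6| := by gcongr; exact abs_add_le _ _
  refine (step _ _ _ _ _ _).trans ?_
  linarith

/-! ### `(r² + a²)³ dV₁/dr = P₁/(r² + a²)²` and its derivative -/

/-- **`d/dr((r² + a²)³ dV₁/dr) = (dP₁/dr·(r² + a²) − 4rP₁)/(r² + a²)³`** at every `r > 0`
(`(r² + a²)³ dV₁/dr = P₁/(r² + a²)²` on `(0, ∞)`). [cite: DafermosRodnianskiShlapentokhrothman2014, Lemma 8.3.1 (proof)] -/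
theorem hasDerivAt_cube_mul_deriv_sepPotential₁ (M a : ℝ) {r : ℝ} (hr : 0 < r) :
    HasDerivAt (fun s ↦ (s ^ 2 + a ^ 2) ^ 3 * deriv (sepPotential₁ M a) s)
      ((critPoly₁Deriv M a r * (r ^ 2 + a ^ 2) - 4 * r * critPoly₁ M a r) / (r ^ 2 + a ^ 2) ^ 3)
      r := by
  have hD : 0 < r ^ 2 + a ^ 2 := by positivity
  have hD' : r ^ 2 + a ^ 2 ≠ 0 := hD.ne'
  have hsq := hasDerivAt_sq_add_sq_pow a 2 r
  have hquot : HasDerivAt (fun s ↦ critPoly₁ M a s / (s ^ 2 + a ^ 2) ^ 2)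
      ((critPoly₁Deriv M a r * (r ^ 2 + a ^ 2) ^ 2 -
          critPoly₁ M a r * ((2 : ℕ) * (r ^ 2 + a ^ 2) ^ (2 - 1) * (2 * r))) /
        ((r ^ 2 + a ^ 2) ^ 2) ^ 2) r :=
    (hasDerivAt_critPoly₁ M a r).div hsq (pow_ne_zero 2 hD')
  have heq : (fun s ↦ (s ^ 2 + a ^ 2) ^ 3 * deriv (sepPotential₁ M a) s) =ᶠ[𝓝 r]
      fun s ↦ critPoly₁ M a s / (s ^ 2 + a ^ 2) ^ 2 := by
    filter_upwards [Ioi_mem_nhds hr] with s hs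
    have hs' : (0 : ℝ) < s := hs
    have hDs : s ^ 2 + a ^ 2 ≠ 0 := by positivity
    rw [deriv_sepPotential₁_eq M a hDs]
    field_simp
  refine (hquot.congr_of_eventuallyEq heq).congr_deriv ?_
  push_cast
  field_simp
  ring

/-- **`|d/dr((r² + a²)³ dV₁/dr)| ≤ 1792Mr`** for `0 < M ≤ r`, `|a| ≤ M`
(`|dP₁/dr|(r² + a²) ≤ 1056Mr⁷`, `4r|P₁| ≤ 736Mr⁷`, `(r² + a²)³ ≥ r⁶`): the bound
"`|d/dr((r² + a²)³ dV₁/dr)| ≤ Br`" of DRSR arXiv:1402.7034, proof of Lemma 8.3.1, in explicit form.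
[cite: DafermosRodnianskiShlapentokhrothman2014, Lemma 8.3.1 (proof)] -/
theorem abs_deriv_cube_mul_deriv_sepPotential₁_le {M a r : ℝ} (hM : 0 < M) (haM : |a| ≤ M)
    (hr : M ≤ r) :
    |deriv (fun s ↦ (s ^ 2 + a ^ 2) ^ 3 * deriv (sepPotential₁ M a) s) r| ≤ 1792 * M * r := by
  have hr0 : 0 < r := hM.trans_le hr
  have hD : 0 < r ^ 2 + a ^ 2 := by positivity
  have ha2 : a ^ 2 ≤ r ^ 2 := by nlinarith [sq_abs a, abs_nonneg a]
  have hD2 : r ^ 2 + a ^ 2 ≤ 2 * r ^ 2 := by linarith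
  have hP := abs_critPoly₁_le hM haM hr
  have hP' := abs_critPoly₁Deriv_le hM haM hr
  rw [(hasDerivAt_cube_mul_deriv_sepPotential₁ M a hr0).deriv, abs_div, abs_of_pos (pow_pos hD 3)]
  have hnum : |critPoly₁Deriv M a r * (r ^ 2 + a ^ 2) - 4 * r * critPoly₁ M a r| ≤
      1792 * M * r ^ 7 := by
    calc |critPoly₁Deriv M a r * (r ^ 2 + a ^ 2) - 4 * r * critPoly₁ M a r|
        ≤ |critPoly₁Deriv M a r * (r ^ 2 + a ^ 2)| + |4 * r * critPoly₁ M a r| := abs_sub _ _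
      _ = |critPoly₁Deriv M a r| * (r ^ 2 + a ^ 2) + 4 * r * |critPoly₁ M a r| := by
          rw [abs_mul, abs_mul, abs_of_pos hD, abs_of_pos (by positivity : (0 : ℝ) < 4 * r)]
      _ ≤ 528 * M * r ^ 5 * (2 * r ^ 2) + 4 * r * (184 * M * r ^ 6) := by gcongr
      _ = 1792 * M * r ^ 7 := by ring
  calc |critPoly₁Deriv M a r * (r ^ 2 + a ^ 2) - 4 * r * critPoly₁ M a r| / (r ^ 2 + a ^ 2) ^ 3
      ≤ 1792 * M * r ^ 7 / (r ^ 2 + a ^ 2) ^ 3 := by gcongr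
    _ ≤ 1792 * M * r ^ 7 / (r ^ 2) ^ 3 := by
        apply div_le_div_of_nonneg_left (by positivity) (by positivity)
        gcongr; nlinarith [sq_nonneg a]
    _ = 1792 * M * r := by field_simp

/-! ### `d/dr((r² + a²)³ dV/dr) = dP/dr + d/dr((r² + a²)³ dV₁/dr)` -/

/-- **`d/dr((r² + a²)³ dV/dr) = dP/dr + d/dr((r² + a²)³ dV₁/dr)`** at every `r > 0`
(`(r² + a²)³ dV/dr = P + (r² + a²)³ dV₁/dr`). DRSR arXiv:1402.7034, proof of Lemma 8.3.1 (the
passage from `V₀` to `V = V₀ + V₁`). [cite: DafermosRodnianskiShlapentokhrothman2014, Lemma 8.3.1 (proof)] -/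
theorem hasDerivAt_cube_mul_deriv_sepPotential (M a ω : ℝ) (m : ℤ) (Λ : ℝ) {r : ℝ} (hr : 0 < r) :
    HasDerivAt (fun s ↦ (s ^ 2 + a ^ 2) ^ 3 * deriv (sepPotential M a ω m Λ) s)
      (critPolyDeriv M a ω m Λ r +
        (critPoly₁Deriv M a r * (r ^ 2 + a ^ 2) - 4 * r * critPoly₁ M a r) / (r ^ 2 + a ^ 2) ^ 3)
      r := by
  have h := (hasDerivAt_critPoly M a ω m Λ r).add (hasDerivAt_cube_mul_deriv_sepPotential₁ M a hr)
  refine h.congr_of_eventuallyEq ?_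
  filter_upwards [Ioi_mem_nhds hr] with s hs
  have hs' : (0 : ℝ) < s := hs
  have hDs : s ^ 2 + a ^ 2 ≠ 0 := by positivity
  simp only [Pi.add_apply]
  rw [deriv_sepPotential_eq M a ω m Λ hDs, deriv_sepPotential₁_eq M a hDs]
  field_simp

/-- **The two-sided comparison used in Lemmas 8.3.1 and 8.6.1**: for `0 < M ≤ r`, `|a| ≤ M`,
`|d/dr((r² + a²)³ dV/dr) − dP/dr| ≤ 1792Mr`; in particular, where `dP/dr ≤ −c̃Λr²` one has
`d/dr((r² + a²)³ dV/dr) ≤ −c̃Λr² + 1792Mr < 0` as soon as `c̃Λr > 1792M` ("for `ω_high` sufficiently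
large (and hence large `Λ`) … `V` … has a unique maximum `r_max ∈ [r₁', ∞)`", DRSR arXiv:1402.7034,
proof of Lemma 8.3.1). [cite: DafermosRodnianskiShlapentokhrothman2014, Lemma 8.3.1 (proof)] -/
theorem abs_deriv_cube_mul_deriv_sepPotential_sub_le {M a ω Λ r : ℝ} {m : ℤ} (hM : 0 < M)
    (haM : |a| ≤ M) (hr : M ≤ r) :
    |deriv (fun s ↦ (s ^ 2 + a ^ 2) ^ 3 * deriv (sepPotential M a ω m Λ) s) r -
        critPolyDeriv M a ω m Λ r| ≤ 1792 * M * r := by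
  have hr0 : 0 < r := hM.trans_le hr
  rw [(hasDerivAt_cube_mul_deriv_sepPotential M a ω m Λ hr0).deriv, add_sub_cancel_left,
    ← (hasDerivAt_cube_mul_deriv_sepPotential₁ M a hr0).deriv]
  exact abs_deriv_cube_mul_deriv_sepPotential₁_le hM haM hr

/-! ### The second derivatives of `V₁` and `V` -/

/-- **`d²V₁/dr² = (dP₁/dr·(r² + a²) − 10rP₁)/(r² + a²)⁶`** at every `r > 0`. [folklore] -/
theorem hasDerivAt_deriv_sepPotential₁ (M a : ℝ) {r : ℝ} (hr : 0 < r) :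
    HasDerivAt (deriv (sepPotential₁ M a))
      ((critPoly₁Deriv M a r * (r ^ 2 + a ^ 2) - 10 * r * critPoly₁ M a r) / (r ^ 2 + a ^ 2) ^ 6)
      r := by
  have hD : 0 < r ^ 2 + a ^ 2 := by positivity
  have hD' : r ^ 2 + a ^ 2 ≠ 0 := hD.ne'
  have h5 := hasDerivAt_sq_add_sq_pow a 5 r
  have hquot : HasDerivAt (fun s ↦ critPoly₁ M a s / (s ^ 2 + a ^ 2) ^ 5)
      ((critPoly₁Deriv M a r * (r ^ 2 + a ^ 2) ^ 5 -
          critPoly₁ M a r * ((5 : ℕ) * (r ^ 2 + a ^ 2) ^ (5 - 1) * (2 * r))) /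
        ((r ^ 2 + a ^ 2) ^ 5) ^ 2) r :=
    (hasDerivAt_critPoly₁ M a r).div h5 (pow_ne_zero 5 hD')
  have heq : deriv (sepPotential₁ M a) =ᶠ[𝓝 r] fun s ↦ critPoly₁ M a s / (s ^ 2 + a ^ 2) ^ 5 := by
    filter_upwards [Ioi_mem_nhds hr] with s hs
    have hs' : (0 : ℝ) < s := hs
    exact deriv_sepPotential₁_eq M a (by positivity : s ^ 2 + a ^ 2 ≠ 0)
  refine (hquot.congr_of_eventuallyEq heq).congr_deriv ?_
  push_cast
  field_simp
  ring

/-- **`|d²V₁/dr²| ≤ 2896M/r⁵`** for `0 < M ≤ r`, `|a| ≤ M`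
(`|dP₁/dr|(r² + a²) ≤ 1056Mr⁷`, `10r|P₁| ≤ 1840Mr⁷`, `(r² + a²)⁶ ≥ r¹²`). [folklore] -/
theorem abs_deriv_deriv_sepPotential₁_le {M a r : ℝ} (hM : 0 < M) (haM : |a| ≤ M) (hr : M ≤ r) :
    |deriv (deriv (sepPotential₁ M a)) r| ≤ 2896 * M / r ^ 5 := by
  have hr0 : 0 < r := hM.trans_le hr
  have hD : 0 < r ^ 2 + a ^ 2 := by positivity
  have ha2 : a ^ 2 ≤ r ^ 2 := by nlinarith [sq_abs a, abs_nonneg a]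
  have hD2 : r ^ 2 + a ^ 2 ≤ 2 * r ^ 2 := by linarith
  have hP := abs_critPoly₁_le hM haM hr
  have hP' := abs_critPoly₁Deriv_le hM haM hr
  rw [(hasDerivAt_deriv_sepPotential₁ M a hr0).deriv, abs_div, abs_of_pos (pow_pos hD 6)]
  have hnum : |critPoly₁Deriv M a r * (r ^ 2 + a ^ 2) - 10 * r * critPoly₁ M a r| ≤
      2896 * M * r ^ 7 := by
    calc |critPoly₁Deriv M a r * (r ^ 2 + a ^ 2) - 10 * r * critPoly₁ M a r|
        ≤ |critPoly₁Deriv M a r * (r ^ 2 + a ^ 2)| + |10 * r * critPoly₁ M a r| := abs_sub _ _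
      _ = |critPoly₁Deriv M a r| * (r ^ 2 + a ^ 2) + 10 * r * |critPoly₁ M a r| := by
          rw [abs_mul, abs_mul, abs_of_pos hD, abs_of_pos (by positivity : (0 : ℝ) < 10 * r)]
      _ ≤ 528 * M * r ^ 5 * (2 * r ^ 2) + 10 * r * (184 * M * r ^ 6) := by gcongr
      _ = 2896 * M * r ^ 7 := by ring
  calc |critPoly₁Deriv M a r * (r ^ 2 + a ^ 2) - 10 * r * critPoly₁ M a r| / (r ^ 2 + a ^ 2) ^ 6
      ≤ 2896 * M * r ^ 7 / (r ^ 2 + a ^ 2) ^ 6 := by gcongr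
    _ ≤ 2896 * M * r ^ 7 / (r ^ 2) ^ 6 := by
        apply div_le_div_of_nonneg_left (by positivity) (by positivity)
        gcongr; nlinarith [sq_nonneg a]
    _ = 2896 * M / r ^ 5 := by field_simp

/-- **`d²V/dr² = d²V₀/dr² + d²V₁/dr²`** at every `r > 0` (as a `HasDerivAt` statement for
`deriv V`). [cite: DafermosRodnianskiShlapentokhrothman2014, §6.2] -/
theorem hasDerivAt_deriv_sepPotential (M a ω : ℝ) (m : ℤ) (Λ : ℝ) {r : ℝ} (hr : 0 < r) :
    HasDerivAt (deriv (sepPotential M a ω m Λ))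
      ((critPolyDeriv M a ω m Λ r * (r ^ 2 + a ^ 2) - 6 * r * critPoly M a ω m Λ r) /
          (r ^ 2 + a ^ 2) ^ 4 +
        (critPoly₁Deriv M a r * (r ^ 2 + a ^ 2) - 10 * r * critPoly₁ M a r) / (r ^ 2 + a ^ 2) ^ 6)
      r := by
  have h := (hasDerivAt_deriv_sepPotential₀ M a ω m Λ hr).add (hasDerivAt_deriv_sepPotential₁ M a hr)
  refine h.congr_of_eventuallyEq ?_
  filter_upwards [Ioi_mem_nhds hr] with s hs
  have hs' : (0 : ℝ) < s := hs
  have hDs : s ^ 2 + a ^ 2 ≠ 0 := by positivity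
  simp only [Pi.add_apply]
  rw [deriv_sepPotential_eq M a ω m Λ hDs, deriv_sepPotential₀_eq M a ω m Λ hDs,
    deriv_sepPotential₁_eq M a hDs]

/-- **`|d²V/dr²| ≤ 216Λ/r⁴ + 2896M/r⁵`** for `0 < M ≤ r`, `|a| ≤ M` and an admissible triple: the
second-order companion of (someBoundS) (`|dV/dr| ≤ 24Λ/r³ + 184M/r⁴`,
`KerrSeparatedPotentialBounds.abs_deriv_sepPotential_le`), quantifying "`|d²V₀/dr²| ≤ BΛ`" of DRSR
arXiv:1402.7034, proof of Lemma 8.3.1, for the full potential. [cite: DafermosRodnianskiShlapentokhrothman2014, Lemma 8.3.1 (proof)] -/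
theorem abs_deriv_deriv_sepPotential_le {M a ω Λ r : ℝ} {m : ℤ} (hM : 0 < M) (haM : |a| ≤ M)
    (hadm : IsAdmissibleTriple a ω m Λ) (hr : M ≤ r) :
    |deriv (deriv (sepPotential M a ω m Λ)) r| ≤ 216 * Λ / r ^ 4 + 2896 * M / r ^ 5 := by
  have hr0 : 0 < r := hM.trans_le hr
  rw [(hasDerivAt_deriv_sepPotential M a ω m Λ hr0).deriv,
    ← deriv_deriv_sepPotential₀_eq M a ω m Λ hr0, ← (hasDerivAt_deriv_sepPotential₁ M a hr0).deriv]
  exact (abs_add_le _ _).trans (add_le_add (abs_deriv_deriv_sepPotential₀_le hM haM hadm hr)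
    (abs_deriv_deriv_sepPotential₁_le hM haM hr))

end Kerr

end Literature.Geometry.Lorentzian

end
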